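import Summits.CriticalPhenomena.PercolationContinuityZ3.Theses.PercLowPointHalfSpace
import Summits.CriticalPhenomena.PercolationContinuityZ3.Theorems.PercLowPointHalfSpaceQuantitativeBGNKlTransfer
import Summits.CriticalPhenomena.PercolationContinuityZ3.Theorems.PercLowPointHalfSpaceQuantitativeBGNMirrorSymm
import Summits.CriticalPhenomena.PercolationContinuityZ3.Theorems.PercLowPointHalfSpaceQuantitativeBGNMirrorSealing
import Literature.Probability.Percolation.TwoGhostInequalityProofs
import Literature.Probability.Percolation.FiniteEnergy
import Literature.Probability.Percolation.HalfSpaceProofs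
import Literature.Probability.Percolation.MeanFieldBetaFromGamma
import Literature.Probability.Percolation.CriticalContinuityProofs
import HarnessLib

/-!
# Thin-foot PACKING bound (crux `QuantitativeBGN`, stmt-CriticalPhenomena-0913), part 1: mass transport + sealing

Line `mirror-akn-two-arm-import`, lead prover-line-stmt-CriticalPhenomena-0913-c1-0; `--supports stmt-CriticalPhenomena-0913`.
Objects (expanded, no new definitions): `H⁻ = withinGraph (zdGraph 3) {x | x 0 ≤ 0}` rooted at `0`,
`volDn n = {n ≤ |C_{H⁻}(0)|}`, `footLe k = {|C_{H⁻}(0) ∩ {x₀ = 0}| ≤ k}`.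

* `ThinFootPacking.measure_top_le` — VERTEX MASS TRANSPORT on `ℤ³`: the probability that the bulk cluster of
  `0` is finite, has `≥ n` vertices, lies in `{x₀ ≤ 0}` and meets the level `{x₀ = 0}` in `≤ k` sites is `≤ k/n`
  (each such top vertex spreads unit mass over its cluster; `0` receives `#top/|C| ≤ k/n`).
* `thinFoot_packing` (registered sub-goal) — **`(1 − p)^k · P_p(volDn n ∩ footLe k) ≤ k/n + P_p(C_{H⁻}(0) infinite)`**
  for every `p`, `n ≥ 1`, `k`: seal the `≤ k` vertical edges above the foot (finite energy); the bulk cluster of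
  `0` is then the half-space cluster, hanging below its top vertex `0` (`MirrorSealing.openCluster_subset_of_sealed`).
Part 2 (`…ThinFootCostume.lean`) specialises to `p_c` (BGN kills the last term) and derives the crux directly from
the registered stub `stub_thinFootRel`, showing that stub to be a costume of the crux.
-/

noncomputable section

namespace Summit.CriticalPhenomena.PercolationContinuityZ3.Theorems

open MeasureTheory Filter
open Literature.Probability.Percolation Literature.Probability.LatticeModels
open scoped ENNReal Topology
namespace ThinFootPacking


/-! ### Vertex mass transport: `P(0 is a top vertex of a finite cluster with ≥ n vertices and ≤ k top vertices) ≤ k/n` -/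

/-- Translation covariance of the "top vertex" data: shifting the configuration by `u` carries the
event "`C(x)` is finite, lies weakly below the level of `x`, has `≥ n` vertices and `≤ k` of them on
the level of `x`" at `x` to the same event at `x + u`, and `C(x)` to `C(x) + u`. -/
theorem top_shift_iff (u : Site 3) (ω : BondConfig (Site 3)) (x : Site 3) (n k : ℕ) :
    ((openCluster (TwoGhost.shiftConfig u ω) (x + u)).Finite ∧
        openCluster (TwoGhost.shiftConfig u ω) (x + u) ⊆ {y : Site 3 | y 0 ≤ (x + u) 0} ∧
        (n : ℕ∞) ≤ (openCluster (TwoGhost.shiftConfig u ω) (x + u)).encard ∧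
        (openCluster (TwoGhost.shiftConfig u ω) (x + u) ∩ {y : Site 3 | y 0 = (x + u) 0}).encard ≤ k) ↔
      ((openCluster ω x).Finite ∧ openCluster ω x ⊆ {y : Site 3 | y 0 ≤ x 0} ∧
        (n : ℕ∞) ≤ (openCluster ω x).encard ∧ (openCluster ω x ∩ {y : Site 3 | y 0 = x 0}).encard ≤ k) := by
  have hC := TwoGhost.openCluster_shiftConfig u ω x
  have hinj : Function.Injective (fun y : Site 3 => y + u) := add_left_injective u
  rw [hC, hinj.encard_image]
  have hsub : (fun y : Site 3 => y + u) '' openCluster ω x ⊆ {y : Site 3 | y 0 ≤ (x + u) 0} ↔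
      openCluster ω x ⊆ {y : Site 3 | y 0 ≤ x 0} := by
    simp only [Set.image_subset_iff, Set.preimage_setOf_eq, Pi.add_apply, add_le_add_iff_right]
  have hlev : (fun y : Site 3 => y + u) '' openCluster ω x ∩ {y : Site 3 | y 0 = (x + u) 0} =
      (fun y : Site 3 => y + u) '' (openCluster ω x ∩ {y : Site 3 | y 0 = x 0}) := by
    ext z
    simp only [Set.mem_inter_iff, Set.mem_image, Set.mem_setOf_eq, Pi.add_apply]
    constructor
    · rintro ⟨⟨y, hy, rfl⟩, hz⟩
      exact ⟨y, ⟨hy, by simpa using hz⟩, rfl⟩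
    · rintro ⟨y, ⟨hy, hy0⟩, rfl⟩
      exact ⟨⟨y, hy, rfl⟩, by simpa using hy0⟩
  simp only [hsub, hlev, hinj.encard_image, Set.finite_image_iff hinj.injOn]

open Classical in
/-- **Mass-transport bound.** For bond percolation on `ℤ³` at any `p` and `n ≥ 1`:
`P(C(0) finite, C(0) ⊆ {x₀ ≤ 0}, |C(0)| ≥ n, |C(0) ∩ {x₀ = 0}| ≤ k) ≤ k/n`. Transport: every vertex `u`
that is a top vertex of its finite cluster (cluster weakly below `u`'s level, `≥ n` vertices, `≤ k` on the
level) sends mass `1/|C(u)|` to each vertex of `C(u)`; the mass sent by `0` is the indicator of the event,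
the mass received by `0` is `#{top vertices of C(0)}/|C(0)| ≤ k/n`, and the two have equal expectations by
translation invariance (`TwoGhost.lintegral_shiftConfig`, reindexing `v ↦ −v`). -/
theorem measure_top_le (p : unitInterval) (n k : ℕ) :
    bondPercolation (zdGraph 3) p
        {ω | (openCluster ω 0).Finite ∧ openCluster ω 0 ⊆ {y : Site 3 | y 0 ≤ (0 : Site 3) 0} ∧
          (n : ℕ∞) ≤ (openCluster ω 0).encard ∧
          (openCluster ω 0 ∩ {y : Site 3 | y 0 = (0 : Site 3) 0}).encard ≤ k} ≤
      (k : ℝ≥0∞) / n := by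
  set P := bondPercolation (zdGraph 3) p with hP
  -- the "top vertex" event at `u`
  set A : Site 3 → Set (BondConfig (Site 3)) := fun u =>
    {ω | (openCluster ω u).Finite ∧ openCluster ω u ⊆ {y : Site 3 | y 0 ≤ u 0} ∧
      (n : ℕ∞) ≤ (openCluster ω u).encard ∧ (openCluster ω u ∩ {y : Site 3 | y 0 = u 0}).encard ≤ k}
    with hA
  -- the transport
  set φ : BondConfig (Site 3) → Site 3 → Site 3 → ℝ≥0∞ := fun ω u v =>
    if ω ∈ A u ∧ v ∈ openCluster ω u then (((openCluster ω u).ncard : ℕ) : ℝ≥0∞)⁻¹ else 0 with hφ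
  -- (1) mass sent by `0`: `Σ_v φ ω 0 v = 1_{A 0}(ω)`
  have hsent : ∀ ω, ∑' v, φ ω 0 v = (A 0).indicator 1 ω := by
    intro ω
    by_cases hω : ω ∈ A 0
    · rw [Set.indicator_of_mem hω, Pi.one_apply]
      have hfin : (openCluster ω 0).Finite := hω.1
      have hterm : ∀ v, φ ω 0 v = (openCluster ω 0).indicator
          (fun _ => (((openCluster ω 0).ncard : ℕ) : ℝ≥0∞)⁻¹) v := by
        intro v
        by_cases hv : v ∈ openCluster ω 0
        · rw [Set.indicator_of_mem hv]; simp only [hφ, if_pos (And.intro hω hv)]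
        · rw [Set.indicator_of_notMem hv]; simp only [hφ]; rw [if_neg (fun h => hv h.2)]
      rw [tsum_congr hterm, ← tsum_subtype, ENNReal.tsum_set_const, hfin.encard_eq_coe]
      have hne : (openCluster ω 0).ncard ≠ 0 := Set.ncard_ne_zero_of_mem (mem_openCluster_self ω 0) hfin
      show (((openCluster ω 0).ncard : ℕ∞) : ℝ≥0∞) * ((((openCluster ω 0).ncard : ℕ) : ℝ≥0∞))⁻¹ = 1
      rw [ENat.toENNReal_coe]
      exact ENNReal.mul_inv_cancel (by exact_mod_cast hne) (ENNReal.natCast_ne_top _)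
    · rw [Set.indicator_of_notMem hω]
      refine ENNReal.tsum_eq_zero.2 fun v => ?_
      simp only [hφ]
      rw [if_neg (fun h => hω h.1)]
  -- (2) mass received by `0`: `Σ_u φ ω u 0 ≤ k/n`
  have hrecv : ∀ ω, ∑' u, φ ω u 0 ≤ (k : ℝ≥0∞) / n := by
    intro ω
    -- the senders to `0`
    set U : Set (Site 3) := {u | ω ∈ A u ∧ (0 : Site 3) ∈ openCluster ω u} with hU
    by_cases hUe : U = ∅
    · have : ∀ u, φ ω u 0 = 0 := by
        intro u
        simp only [hφ]
        rw [if_neg]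
        intro h
        have : u ∈ U := h
        rw [hUe] at this
        exact this
      rw [tsum_congr this, tsum_zero]
      exact zero_le
    obtain ⟨u₀, hu₀⟩ := Set.nonempty_iff_ne_empty.2 hUe
    have hC0 : ∀ u ∈ U, openCluster ω u = openCluster ω 0 := fun u hu =>
      (TwoGhost.openCluster_eq_of_mem hu.2).symm
    -- all senders lie on the level of `u₀`, inside `C(u₀)`
    have hUsub : U ⊆ openCluster ω u₀ ∩ {y : Site 3 | y 0 = u₀ 0} := by
      intro u hu
      have hCu : openCluster ω u = openCluster ω u₀ := (hC0 u hu).trans (hC0 u₀ hu₀).symm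
      have hu_mem : u ∈ openCluster ω u₀ := hCu ▸ mem_openCluster_self ω u
      have hu0_mem : u₀ ∈ openCluster ω u := hCu.symm ▸ mem_openCluster_self ω u₀
      have h1 : u 0 ≤ u₀ 0 := hu₀.1.2.1 hu_mem
      have h2 : u₀ 0 ≤ u 0 := hu.1.2.1 hu0_mem
      exact ⟨hu_mem, le_antisymm h1 h2⟩
    have hUcard : U.encard ≤ k := (Set.encard_le_encard hUsub).trans hu₀.1.2.2.2
    have hterm : ∀ u, φ ω u 0 = U.indicator (fun _ => (((openCluster ω 0).ncard : ℕ) : ℝ≥0∞)⁻¹) u := by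
      intro u
      by_cases hu : u ∈ U
      · rw [Set.indicator_of_mem hu]
        simp only [hφ]
        rw [if_pos (show ω ∈ A u ∧ (0 : Site 3) ∈ openCluster ω u from hu), hC0 u hu]
      · rw [Set.indicator_of_notMem hu]
        simp only [hφ]
        rw [if_neg (show ¬ (ω ∈ A u ∧ (0 : Site 3) ∈ openCluster ω u) from hu)]
    rw [tsum_congr hterm, ← tsum_subtype, ENNReal.tsum_set_const]
    -- `|C(0)| ≥ n`
    have hfin0 : (openCluster ω 0).Finite := (hC0 u₀ hu₀) ▸ hu₀.1.1
    have hn0 : (n : ℕ∞) ≤ (openCluster ω 0).encard := (hC0 u₀ hu₀) ▸ hu₀.1.2.2.1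
    have hncard : n ≤ (openCluster ω 0).ncard := by
      rw [hfin0.encard_eq_coe_toFinset_card] at hn0
      rw [Set.ncard_eq_toFinset_card _ hfin0]
      exact_mod_cast hn0
    calc U.encard * ((((openCluster ω 0).ncard : ℕ) : ℝ≥0∞))⁻¹
        ≤ (k : ℝ≥0∞) * ((n : ℝ≥0∞))⁻¹ := by
          refine mul_le_mul' ?_ ?_
          · have : (U.encard : ℝ≥0∞) ≤ ((k : ℕ∞) : ℝ≥0∞) := by exact_mod_cast hUcard
            simpa using this
          · exact ENNReal.inv_le_inv.2 (by exact_mod_cast hncard)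
      _ = (k : ℝ≥0∞) / n := by rw [div_eq_mul_inv]
  -- (3) covariance of `φ` under translations
  have hcov : ∀ (u : Site 3) (ω : BondConfig (Site 3)) (x y : Site 3),
      φ (TwoGhost.shiftConfig u ω) (x + u) (y + u) = φ ω x y := by
    intro u ω x y
    have hAiff : TwoGhost.shiftConfig u ω ∈ A (x + u) ↔ ω ∈ A x := top_shift_iff u ω x n k
    have hmem : y + u ∈ openCluster (TwoGhost.shiftConfig u ω) (x + u) ↔ y ∈ openCluster ω x :=
      TwoGhost.add_mem_openCluster_shiftConfig_iff u ω x y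
    have hnc : (openCluster (TwoGhost.shiftConfig u ω) (x + u)).ncard = (openCluster ω x).ncard :=
      TwoGhost.ncard_openCluster_shiftConfig u ω x
    simp only [hφ, hnc]
    by_cases h : ω ∈ A x ∧ y ∈ openCluster ω x
    · rw [if_pos h, if_pos (And.intro (hAiff.2 h.1) (hmem.2 h.2))]
    · rw [if_neg h, if_neg (fun h' => h ⟨hAiff.1 h'.1, hmem.1 h'.2⟩)]
  -- (4) measurability of `ω ↦ φ ω u v` (a function of the finite-cluster data at `u`)
  have hmeasφ : ∀ u v, Measurable fun ω => φ ω u v := by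
    intro u v
    -- `φ ω u v` as a function of `cdata ω u`
    let ψ : TwoGhost.CData (Site 3) → ℝ≥0∞ := fun c =>
      match c.val with
      | none => 0
      | some (S, _) =>
        if ((↑S : Set (Site 3)) ⊆ {y : Site 3 | y 0 ≤ u 0} ∧ (n : ℕ∞) ≤ (↑S : Set (Site 3)).encard ∧
            ((↑S : Set (Site 3)) ∩ {y : Site 3 | y 0 = u 0}).encard ≤ k) ∧ v ∈ S
        then ((S.card : ℕ) : ℝ≥0∞)⁻¹ else 0
    have hψ : ∀ ω, φ ω u v = ψ (TwoGhost.cdata (zdGraph 3) ω u) := by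
      intro ω
      by_cases hfin : (openCluster ω u).Finite
      · rw [TwoGhost.cdata_of_finite hfin]
        simp only [hφ, ψ, Set.Finite.coe_toFinset, Set.Finite.mem_toFinset,
          ← Set.ncard_eq_toFinset_card _ hfin]
        by_cases h : ω ∈ A u ∧ v ∈ openCluster ω u
        · rw [if_pos h, if_pos ⟨⟨h.1.2.1, h.1.2.2.1, h.1.2.2.2⟩, h.2⟩]
        · rw [if_neg h, if_neg]
          rintro ⟨⟨h1, h2, h3⟩, h4⟩
          exact h ⟨⟨hfin, h1, h2, h3⟩, h4⟩
      · rw [TwoGhost.cdata_of_infinite hfin]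
        simp only [hφ, ψ]
        rw [if_neg (fun h => hfin h.1.1)]
    simp_rw [hψ]
    exact TwoGhost.measurable_comp_cdata u ψ
  -- (5) assemble: `P(A 0) = ∫ Σ_v φ ω 0 v = Σ_v ∫ φ ω (-v) 0 = ∫ Σ_u φ ω u 0 ≤ k/n`
  have hmeasA : MeasurableSet (A 0) := by
    have : A 0 = (fun ω => (A 0).indicator (1 : BondConfig (Site 3) → ℝ≥0∞) ω) ⁻¹' {1} := by
      ext ω
      by_cases h : ω ∈ A 0
      · simp [h]
      · simp [h]
    have hm : Measurable fun ω => (A 0).indicator (1 : BondConfig (Site 3) → ℝ≥0∞) ω := by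
      have : (fun ω => (A 0).indicator (1 : BondConfig (Site 3) → ℝ≥0∞) ω) = fun ω => ∑' v, φ ω 0 v :=
        funext fun ω => (hsent ω).symm
      rw [this]
      exact Measurable.tsum fun v => hmeasφ 0 v
    rw [this]
    exact hm (measurableSet_singleton 1)
  calc P (A 0) = ∫⁻ ω, (A 0).indicator 1 ω ∂P := (lintegral_indicator_one hmeasA).symm
    _ = ∫⁻ ω, ∑' v, φ ω 0 v ∂P := lintegral_congr fun ω => (hsent ω).symm
    _ = ∑' v, ∫⁻ ω, φ ω 0 v ∂P := lintegral_tsum fun v => (hmeasφ 0 v).aemeasurable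
    _ = ∑' v, ∫⁻ ω, φ ω (-v) 0 ∂P := by
        refine tsum_congr fun v => ?_
        have h1 : ∀ ω, φ ω 0 v = φ (TwoGhost.shiftConfig (-v) ω) (-v) 0 := by
          intro ω
          have := hcov (-v) ω 0 v
          simp only [zero_add, add_neg_cancel] at this
          exact this.symm
        simp_rw [h1]
        exact TwoGhost.lintegral_shiftConfig (-v) p (fun ω => φ ω (-v) 0)
    _ = ∑' u, ∫⁻ ω, φ ω u 0 ∂P := by
        have h := Equiv.tsum_eq (Equiv.neg (Site 3)) (fun u => ∫⁻ ω, φ ω u 0 ∂P)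
        simp only [Equiv.neg_apply] at h
        exact h
    _ = ∫⁻ ω, ∑' u, φ ω u 0 ∂P := (lintegral_tsum fun u => (hmeasφ u 0).aemeasurable).symm
    _ ≤ ∫⁻ _, (k : ℝ≥0∞) / n ∂P := lintegral_mono fun ω => hrecv ω
    _ = (k : ℝ≥0∞) / n := by rw [lintegral_const, measure_univ, mul_one]

end ThinFootPacking

open ThinFootPacking in
/-- **Thin-foot packing bound** (every `p`, `n ≥ 1`, `k`):
`(1 − p)^k · P_p(volDn n ∩ footLe k) ≤ k/n + P_p(C_{H⁻}(0) infinite)`, where `volDn n = {n ≤ |C_{H⁻}(0)|}`,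
`footLe k = {|C_{H⁻}(0) ∩ {x₀ = 0}| ≤ k}`, `H⁻ = withinGraph (zdGraph 3) {x₀ ≤ 0}`. Proof: closing the `≤ k`
vertical edges above the foot costs `(1−p)^k` (finite energy, conditionally on the half-configuration) and
SEALS the cluster (`MirrorSealing.openCluster_subset_of_sealed`): the bulk cluster of `0` is then the
half-space cluster itself, lying below its top vertex `0` with `≤ k` top vertices; if finite it is charged
`≤ k/n` by the mass transport `ThinFootPacking.measure_top_le`, if infinite it is charged to the last term. -/
theorem thinFoot_packing :
    ∀ (p : unitInterval) (n k : ℕ), 1 ≤ n → (1 - (p : ℝ)) ^ k *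
        (bondPercolation (zdGraph 3) p).real
          ({ω | (n : ℕ∞) ≤ (openClusterIn (withinGraph (zdGraph 3) {x : Site 3 | x 0 ≤ 0}) ω 0).encard} ∩
            {ω | (openClusterIn (withinGraph (zdGraph 3) {x : Site 3 | x 0 ≤ 0}) ω 0 ∩ {x : Site 3 | x 0 = 0}).encard ≤ k}) ≤
      (k : ℝ) / n +
        (bondPercolation (zdGraph 3) p).real
          {ω | (openClusterIn (withinGraph (zdGraph 3) {x : Site 3 | x 0 ≤ 0}) ω 0).Infinite} := by
  intro p n k hn
  classical
  set P := bondPercolation (zdGraph 3) p with hP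
  set Kdn : SimpleGraph (Site 3) := withinGraph (zdGraph 3) {x : Site 3 | x 0 ≤ 0} with hKdn
  set L0 : Set (Site 3) := {x : Site 3 | x 0 = 0} with hL0
  set Dn : Set (BondConfig (Site 3)) := {ω | (n : ℕ∞) ≤ (openClusterIn Kdn ω 0).encard} with hDn
  set Ft : Set (BondConfig (Site 3)) := {ω | (openClusterIn Kdn ω 0 ∩ L0).encard ≤ k} with hFt
  set Inf : Set (BondConfig (Site 3)) := {ω | (openClusterIn Kdn ω 0).Infinite} with hInf
  set Top0 : Set (BondConfig (Site 3)) :=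
    {ω | (openCluster ω 0).Finite ∧ openCluster ω 0 ⊆ {y : Site 3 | y 0 ≤ (0 : Site 3) 0} ∧
      (n : ℕ∞) ≤ (openCluster ω 0).encard ∧
      (openCluster ω 0 ∩ {y : Site 3 | y 0 = (0 : Site 3) 0}).encard ≤ k} with hTop0
  -- the foot statistic and the edges to close (as in `mirror_sealing_bound`)
  set foot : BondConfig (Site 3) → Set (Site 3) := fun ω => openClusterIn Kdn ω 0 ∩ L0 with hfoot
  set Ψ : BondConfig (Site 3) → Finset (Site 3) := fun ω =>
    if h : (foot ω).Finite then h.toFinset else ∅ with hΨ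
  set φ : Finset (Site 3) → Finset (Sym2 (Site 3)) := fun B => B.image fun v => s(v, v + Pi.single 0 1) with hφ
  set A : Set (BondConfig (Site 3)) := Dn ∩ Ft with hA
  have hfin : ∀ ω ∈ Ft, (foot ω).Finite := fun ω hω => Set.finite_of_encard_le_coe hω
  have hΨeq : ∀ ω ∈ Ft, (↑(Ψ ω) : Set (Site 3)) = foot ω := by
    intro ω hω
    simp only [hΨ, dif_pos (hfin ω hω), Set.Finite.coe_toFinset]
  have hΨcard : ∀ ω ∈ Ft, (Ψ ω).card ≤ k := by
    intro ω hω
    have h1 := (hfin ω hω).encard_eq_coe_toFinset_card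
    have h2 : (foot ω).encard ≤ k := hω
    rw [h1] at h2
    simp only [hΨ, dif_pos (hfin ω hω)]
    exact_mod_cast h2
  have hslice : ∀ B : Finset (Site 3), A ∩ Ψ ⁻¹' {B} = A ∩ {ω | foot ω = ↑B} := by
    intro B
    ext ω
    simp only [Set.mem_inter_iff, Set.mem_preimage, Set.mem_singleton_iff, Set.mem_setOf_eq]
    constructor
    · rintro ⟨hωA, rfl⟩
      exact ⟨hωA, (hΨeq ω hωA.2).symm⟩
    · rintro ⟨hωA, hB⟩
      refine ⟨hωA, ?_⟩
      apply Finset.coe_injective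
      rw [hΨeq ω hωA.2, hB]
  have hdet : ∀ B, DeterminedBy (A ∩ Ψ ⁻¹' {B}) Kdn.edgeSet := by
    intro B
    rw [hslice]
    have e : A ∩ {ω | foot ω = ↑B} = {ω | (n : ℕ∞) ≤ (openClusterIn Kdn ω 0).encard ∧
        (openClusterIn Kdn ω 0 ∩ L0).encard ≤ k ∧ openClusterIn Kdn ω 0 ∩ L0 = ↑B} := by
      ext ω; simp only [hA, hDn, hFt, hfoot, Set.mem_inter_iff, Set.mem_setOf_eq, and_assoc]
    rw [e]
    exact MirrorSealing.determinedBy_setOf_openClusterIn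
      (fun C => (n : ℕ∞) ≤ C.encard ∧ (C ∩ L0).encard ≤ k ∧ C ∩ L0 = ↑B)
  have hmeas : ∀ B, MeasurableSet (A ∩ Ψ ⁻¹' {B}) := by
    intro B
    rw [hslice]
    exact ((MirrorSealing.measurableSet_volDn n).inter (MirrorSealing.measurableSet_footLe k)).inter
      (MirrorSealing.measurableSet_foot_eq _)
  have hdisj : ∀ ω ∈ A, Disjoint (↑(φ (Ψ ω)) : Set (Sym2 (Site 3))) Kdn.edgeSet := by
    intro ω hω
    rw [Set.disjoint_left]
    intro e he heS
    rw [Finset.mem_coe] at he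
    simp only [hφ, Finset.mem_image] at he
    obtain ⟨v, hv, rfl⟩ := he
    have hv' : v ∈ foot ω := by rw [← hΨeq ω hω.2]; exact hv
    exact MirrorSealing.edgeUp_notMem_dn hv'.2 heS
  have hcard : ∀ ω ∈ A, (φ (Ψ ω)).card ≤ k := fun ω hω =>
    Finset.card_image_le.trans (hΨcard ω hω.2)
  -- finite energy
  have hFE := bondPercolation_real_finiteEnergy (zdGraph 3) p (A := A) Kdn.edgeSet Ψ φ k hdet hmeas hdisj hcard
  -- sealing: the closed event lies in `Top0 ∪ Inf` (a.s.)
  have hincl : P.real (A ∩ {ω | ∀ e ∈ φ (Ψ ω), e ∉ ω}) ≤ P.real (Top0 ∪ Inf) := by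
    refine DCT16.real_mono_of_forall_subset_edgeSet (zdGraph 3) p fun ω hω hωA => ?_
    obtain ⟨⟨hD, hF⟩, hclosed⟩ := hωA
    have hseal : ∀ v ∈ openClusterIn Kdn ω 0, v 0 = 0 → s(v, v + Pi.single 0 1) ∉ ω := by
      intro v hv hv0
      refine hclosed _ ?_
      simp only [hφ, Finset.mem_image]
      refine ⟨v, ?_, rfl⟩
      rw [← Finset.mem_coe, hΨeq ω hF]
      exact ⟨hv, hv0⟩
    have hCeq : openCluster ω 0 = openClusterIn Kdn ω 0 :=
      Set.Subset.antisymm (MirrorSealing.openCluster_subset_of_sealed hω hseal)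
        (openClusterIn_subset_openCluster _ _ _)
    by_cases hfinS : (openClusterIn Kdn ω 0).Finite
    · left
      refine ⟨hCeq ▸ hfinS, ?_, ?_, ?_⟩
      · rw [hCeq]
        exact openClusterIn_withinGraph_subset (x := (0 : Site 3)) (show (0 : Site 3) 0 ≤ 0 from le_rfl) ω
      · rw [hCeq]; exact hD
      · rw [hCeq]; exact hF
    · right
      exact hfinS
  -- the two charges
  have hTop : P.real Top0 ≤ (k : ℝ) / n := by
    have h1 := measure_top_le p n k
    have hn0 : (n : ℝ≥0∞) ≠ 0 := by exact_mod_cast (show n ≠ 0 by omega)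
    have hfinite : (k : ℝ≥0∞) / n ≠ ⊤ := ENNReal.div_ne_top (ENNReal.natCast_ne_top k) hn0
    have h2 : P.real Top0 ≤ ((k : ℝ≥0∞) / n).toReal := by
      rw [measureReal_def]
      exact ENNReal.toReal_mono hfinite h1
    refine h2.trans (le_of_eq ?_)
    rw [ENNReal.toReal_div, ENNReal.toReal_natCast, ENNReal.toReal_natCast]
  calc (1 - (p : ℝ)) ^ k * P.real (Dn ∩ Ft) = (1 - (p : ℝ)) ^ k * P.real A := by rw [hA]
    _ ≤ P.real (A ∩ {ω | ∀ e ∈ φ (Ψ ω), e ∉ ω}) := hFE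
    _ ≤ P.real (Top0 ∪ Inf) := hincl
    _ ≤ P.real Top0 + P.real Inf := measureReal_union_le _ _
    _ ≤ (k : ℝ) / n + P.real Inf := add_le_add hTop le_rfl

end Summit.CriticalPhenomena.PercolationContinuityZ3.Theorems

end
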